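import Summits.ABC.IUTFork.Joshi.LogVolumesHulls

/-!
# The §9.10 junction needs only a MONOTONE volume: `MonotoneVolumeDatum`, Lem. 9.10.7.1 for it, and a non-degenerate
# multi-factor inhabitant (the outer Γ-weighted volume) — census honesty about `TensorVolumeDatum`

K. Joshi, *Construction of Arithmetic Teichmüller Spaces III* (arXiv:2401.13508 **v4**, unrefereed; bib
`Joshi2024ATS3`), §9.10.3 (9.10.3.1) p.124 l.8–11, §9.10.6 p.125 l.20–26 («for any measurable set S … one can talk of its
volume Vol(S)»), Lem. 9.10.7.1 p.125 l.42–55. Cell abc-iut, block E (rung LADDER-ABC:A2.E), seat E-t23 (slot T-23).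
WHY THIS FILE (Edisonian census of my own p428811): `LogVol.TensorVolumeDatum` types the junction «(9.10.3.1) on ball-tensors +
one volume on the ambient space» with `vol` a MEASURE. Its proof of Lem. 9.10.7.1 uses MONOTONICITY only. And a measure is
MORE than Joshi's recipe can bear for ≥ 2 factors: in `V = ⊗_{ℚ_p} k_i` the scalar `p` moves across the tensor sign
(kernel: `purePacket_update_natCast`, file `LogVolumesHullsPacket`), a Haar measure on the `D`-dimensional `ℚ_p`-space `V`
scales by `p^{−D}` under `p·` (campaign-S `packetLogVolume_natCast_smul_normalizedPacket`: `μ^log(p·(R_I)^∼) = −log p`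
after division by `D`), while (9.10.3.1) scales the tuple with `p` in slot `i` by `p^{−γ_i d_i}` (kernel:
`log_weightedVol_update`); so a measure model forces `γ_i·d_i = D = dim_{ℚ_p} V` for every `i`, i.e. `γ_i = D/d_i ≥ 1`,
incompatible with `Γ ⊂ (0, 1]` except in degenerate cases (one factor, or all other factors `= ℚ_p`) — consistent with
the one-factor `ℚ_p` inhabitants of p430954 / p432258 and with Joshi's Vol being a `(1/D)`-type ROOT of Mochizuki's
packet measure (LOCATION L3/L6; no verdict on print). CONTENT: (1) `MonotoneVolumeDatum` — the same junction with `vol :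
Set X → ℝ≥0∞` merely MONOTONE; (2) Lem. 9.10.7.1 re-proved for it verbatim (`MonotoneVolumeDatum.lemma_9_10_7_1`); (3)
every `TensorVolumeDatum` forgets to one (`TensorVolumeDatum.toMonotone`), so p429037/p429684/p432258 are unaffected;
(4) a NON-DEGENERATE inhabitant for ANY finite family of §9.10.2 data and ANY weights: the OUTER Γ-weighted volume on the
product container `Π_i E_i` (`boxModel`: `vol S = inf` over boxes `⊇ S` of `∏_i Vol(V_i)^{γ_i}`, `tens` = the box,
`hull = id`), with `vol(tens of balls) = ∏ |l_i|^{γ_i} ∈ (0, ∞)` (`boxModel_vol_balls`). FRAMING: typed ≠ proved; no side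
taken on [IUTchIII] Cor. 3.12 or on any author.
-/

noncomputable section

namespace Summit.ABC.IUTFork.Joshi.LogVol

open MeasureTheory
open scoped ENNReal

/-- The §9.10 junction with a MONOTONE volume only (what Lem. 9.10.7.1 uses): `Vol : Set X → ℝ≥0∞` monotone, extending
(9.10.3.1) on ball-tensors, and a hull operator with (P2), (P3). SIGNATURE. [claim: Joshi2024ATS3, status: disputed] -/
structure MonotoneVolumeDatum (ι : Type*) [Fintype ι] (E : ι → Type*) [∀ i, Field (E i)]
    [∀ i, MeasurableSpace (E i)] (X : Type*) where
  /-- the factors -/ D : ∀ i, VolumeDatum (E i)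
  /-- the weights -/ Γ : Weights ι
  /-- `Vol` on subsets of `X` (§9.10.6), only monotone -/ vol : Set X → ℝ≥0∞
  /-- monotonicity -/ vol_mono : ∀ S S', S ⊆ S' → vol S ≤ vol S'
  /-- `(V_i) ↦ V_1 ⊗ … ⊗ V_n ⊂ X` -/ tens : (∀ i, Set (E i)) → Set X
  /-- (9.10.3.1) on ball-tensors -/
  vol_tens : ∀ α l : ∀ i, E i, (∀ i, l i ≠ 0) →
    vol (tens fun i => (D i).ball (α i) (l i)) = ENNReal.ofReal (weightedVol D Γ fun i => (D i).ball (α i) (l i))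
  /-- `hull` -/ hull : Set X → Set X
  /-- (P2) -/ subset_hull : ∀ S, S ⊆ hull S
  /-- (P3) -/ hull_mono : ∀ S S', S ⊆ S' → hull S ⊆ hull S'

namespace MonotoneVolumeDatum

variable {ι : Type*} [Fintype ι] {E : ι → Type*} [∀ i, Field (E i)] [∀ i, MeasurableSpace (E i)] {X : Type*}
  (T : MonotoneVolumeDatum ι E X)

/-- **Lem. 9.10.7.1 for a monotone volume** (p.125 l.42–52), as the TWO halves of the printed chain: `Vol(S) ≥ ∏|s_i|`
(via `∏|s_i|^{γ_i}`, Lem. 9.10.3.2) and `Vol(hull S′) ≥ Vol(hull S) ≥ Vol(S)` — monotonicity replacing `measure_mono` in the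
proof of `TensorVolumeDatum.lemma_9_10_7_1`. PROVED. [claim: Joshi2024ATS3, status: disputed] -/
theorem lemma_9_10_7_1 (τ s : ∀ i, E i) (hτ : ∀ i, τ i ∈ (T.D i).O) (hτ0 : ∀ i, τ i ≠ 0)
    (hs : ∀ i, s i ∈ (T.D i).ball 0 (τ i)) {S' : Set X} (hS' : T.tens (fun i => (T.D i).ball 0 (τ i)) ⊆ S') :
    ENNReal.ofReal (∏ i, (T.D i).abs (s i)) ≤ T.vol (T.tens fun i => (T.D i).ball 0 (τ i)) ∧
      T.vol (T.tens fun i => (T.D i).ball 0 (τ i)) ≤ T.vol (T.hull S') := by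
  have hrpow : ∏ i, (T.D i).abs (s i) ≤ ∏ i, (T.D i).abs (s i) ^ T.Γ.γ i :=
    Finset.prod_le_prod (fun i _ => (T.D i).abs.nonneg _) fun i _ => by
      conv_lhs => rw [← Real.rpow_one ((T.D i).abs (s i))]
      exact Real.rpow_le_rpow_of_exponent_ge' ((T.D i).abs.nonneg _)
        (((T.D i).abs_le_of_mem_ball (hs i)).trans ((T.D i).abs_le_one _ (hτ i))) (T.Γ.pos i).le (T.Γ.le_one i)
  refine ⟨?_, (T.vol_mono _ _ (T.subset_hull _)).trans (T.vol_mono _ _ (T.hull_mono _ S' hS'))⟩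
  calc ENNReal.ofReal (∏ i, (T.D i).abs (s i))
      ≤ ENNReal.ofReal (∏ i, (T.D i).abs (s i) ^ T.Γ.γ i) := ENNReal.ofReal_le_ofReal hrpow
    _ ≤ ENNReal.ofReal (weightedVol T.D T.Γ fun i => (T.D i).ball 0 (τ i)) :=
        ENNReal.ofReal_le_ofReal (prod_abs_rpow_le_weightedVol T.D T.Γ 0 τ s hτ0 hs)
    _ = T.vol (T.tens fun i => (T.D i).ball 0 (τ i)) := (T.vol_tens 0 τ hτ0).symm

end MonotoneVolumeDatum

/-- Every measure-based junction is a monotone one (forget additivity). [folklore] -/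
def TensorVolumeDatum.toMonotone {ι : Type*} [Fintype ι] {E : ι → Type*} [∀ i, Field (E i)]
    [∀ i, MeasurableSpace (E i)] {X : Type*} [MeasurableSpace X] (T : TensorVolumeDatum ι E X) :
    MonotoneVolumeDatum ι E X where
  D := T.D
  Γ := T.Γ
  vol S := T.vol S
  vol_mono _ _ h := measure_mono h
  tens := T.tens
  vol_tens := T.vol_tens
  hull := T.hull
  subset_hull := T.subset_hull
  hull_mono := T.hull_mono

/-! ## A non-degenerate multi-factor inhabitant: the outer Γ-weighted volume on the product container -/

section Box

variable {ι : Type*} [Fintype ι] {E : ι → Type*} [∀ i, Field (E i)] [∀ i, MeasurableSpace (E i)]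
  (D : ∀ i, VolumeDatum (E i)) (Γ : Weights ι)

/-- The Γ-weighted box weight in `ℝ≥0∞`: `∏_i Vol(V_i)^{γ_i}` (infinite volumes allowed). [folklore] -/
def boxWeight (V : ∀ i, Set (E i)) : ℝ≥0∞ := ∏ i, ((D i).vol (V i)) ^ (Γ.γ i)

/-- The box weight is monotone in each factor. [folklore] -/
theorem boxWeight_mono {V V' : ∀ i, Set (E i)} (h : ∀ i, V i ⊆ V' i) : boxWeight D Γ V ≤ boxWeight D Γ V' :=
  Finset.prod_le_prod' fun i _ => ENNReal.rpow_le_rpow (measure_mono (h i)) (Γ.pos i).le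

/-- On ball-tuples the box weight is Joshi's (9.10.3.1) value `∏ |l_i|^{γ_i}`. [folklore] -/
theorem boxWeight_balls (α l : ∀ i, E i) (hl : ∀ i, l i ≠ 0) :
    boxWeight D Γ (fun i => (D i).ball (α i) (l i)) = ENNReal.ofReal (weightedVol D Γ fun i => (D i).ball (α i) (l i)) := by
  rw [weightedVol_ball D Γ α l hl, ENNReal.ofReal_prod_of_nonneg fun i _ => Real.rpow_nonneg ((D i).abs.nonneg _) _]
  refine Finset.prod_congr rfl fun i _ => ?_
  rw [(D i).vol_ball (α i) (hl i), ENNReal.ofReal_rpow_of_nonneg ((D i).abs.nonneg _) (Γ.pos i).le]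

/-- The OUTER Γ-weighted volume of a subset of the product container: `inf` over the boxes containing it. [folklore] -/
def outerVol (S : Set (∀ i, E i)) : ℝ≥0∞ := ⨅ (V : ∀ i, Set (E i)) (_ : S ⊆ Set.univ.pi V), boxWeight D Γ V

/-- The outer volume is monotone. [folklore] -/
theorem outerVol_mono {S S' : Set (∀ i, E i)} (h : S ⊆ S') : outerVol D Γ S ≤ outerVol D Γ S' :=
  le_iInf₂ fun V hV => iInf₂_le V (h.trans hV)

/-- The outer volume of a box of balls is its box weight (boxes of nonempty factors are `⊆`-comparable factorwise).
[folklore] -/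
theorem outerVol_pi_balls (α l : ∀ i, E i) :
    outerVol D Γ (Set.univ.pi fun i => (D i).ball (α i) (l i)) = boxWeight D Γ fun i => (D i).ball (α i) (l i) := by
  refine le_antisymm (iInf₂_le_of_le (fun i => (D i).ball (α i) (l i)) subset_rfl le_rfl)
    (le_iInf₂ fun V hV => boxWeight_mono D Γ fun i => ?_)
  have hne : (Set.univ.pi fun i => (D i).ball (α i) (l i)).Nonempty :=
    ⟨α, fun i _ => ⟨0, (D i).O.zero_mem, by simp⟩⟩
  rcases Set.pi_subset_pi_iff.1 hV with h | h
  · exact h i (Set.mem_univ i)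
  · exact absurd h hne.ne_empty

/-- **The box model**: for ANY finite family of §9.10.2 data and ANY weights, the outer Γ-weighted volume on the product
container `Π_i E_i` with `tens` = the box and `hull = id` is a `MonotoneVolumeDatum`. [folklore] -/
def boxModel : MonotoneVolumeDatum ι E (∀ i, E i) where
  D := D
  Γ := Γ
  vol := outerVol D Γ
  vol_mono _ _ := outerVol_mono D Γ
  tens V := Set.univ.pi V
  vol_tens α l hl := by rw [outerVol_pi_balls D Γ α l, boxWeight_balls D Γ α l hl]
  hull := id
  subset_hull _ := le_rfl
  hull_mono _ _ h := h

/-- **Non-degeneracy of the box model**: the volume of a ball-tensor is the positive real `∏ |l_i|^{γ_i}` — for every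
number of factors and all weights in `(0, 1]` (contrast: a MEASURE model needs `γ_i = D/d_i`, module docstring).
[folklore] -/
theorem boxModel_vol_balls (α l : ∀ i, E i) (hl : ∀ i, l i ≠ 0) :
    (boxModel D Γ).vol ((boxModel D Γ).tens fun i => (D i).ball (α i) (l i))
        = ENNReal.ofReal (∏ i, (D i).abs (l i) ^ Γ.γ i) ∧
      0 < ∏ i, (D i).abs (l i) ^ Γ.γ i := by
  refine ⟨?_, Finset.prod_pos fun i _ => Real.rpow_pos_of_pos ((D i).abs.pos (hl i)) _⟩
  change outerVol D Γ (Set.univ.pi fun i => (D i).ball (α i) (l i)) = _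
  rw [outerVol_pi_balls D Γ α l, boxWeight_balls D Γ α l hl, weightedVol_ball D Γ α l hl]

end Box

end Summit.ABC.IUTFork.Joshi.LogVol

end
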